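import Summits.QuantumFields.BalabanUV.Beta.SpineRecursiveWLawSym

/-!
# `BalabanUV.Beta.SpineRecursiveT2AllSym` — binder row D1, (N7c-ii) of the second-order hR slot port: **THE SECOND-ORDER LETTER LAW (hT2-rem) AT EVERY
# LEVEL BY INDUCTION, FOR THE SLOTTED TABLES AT THE (0.4) LITERAL'S SYMMETRISED RESOLVENTS** — from the level-`0` letter, the mixed letter at every level,
# the border letter at every level, the split identities and localisations, the pure tables' first-order law at every level, (V-ff0), (H-r), the shift
# letters and the two units locks; the remainder `R2` is the user's, DEFINED by the displayed recursion (hR2succ) whose step carries the four inner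
# SANDWICH-DEFECT words of `SecondOrderInverseShapeDefect.K3_sharp_defect` — slot twin of `SpineRecursiveT2All.T2RecAt_bref_all_of_letters` (an2 gen 18)
# (β sub-cell, BINDER-OWNERS row D1 OWNER `b2b-balaban-beta-an2`, gen 31; memo `gen30/N7-SCOPE.v1.md` §4 (N7c), RULING R-D1-g28-2)

HONEST FRAMING (cell charter, verbatim): «discharging BetaPertH makes Bałaban's UV stability UNCONDITIONAL — a real constructive-QFT result; it is
NOT the continuum limit and NOT the Clay problem.»  HONEST DEPENDENCY: continuum YM on T⁴ ⇐ BetaPertH ∧ nine spine estimates (0/9 proved); BetaPertH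
⇐ (D1) ∧ (D4) ∧ CAP+tail; G-an2-4 gates asym, D1 and NE2/3/4.  DERIVED cell leaf (wiring, [folklore]): induction on the level with step =
`SpineRecursiveWLawSym.WrecOf_bref_of_T2RM_sym` then `SpineRecursiveT2StepSym.T2RecOf_succ_bref_of_laws_sym`; no statement of Bałaban's papers, no `[cite:]`,
no `def`, no `Prop` fact; EVERY LETTER IS A HYPOTHESIS; instantiates no binder of the wall.  NOT D1, NOT `BetaPertH`, NOT continuum, NOT Clay.

## What is here (notation of `SpineRecursiveT2StepSym`; `Rm_j := ½•conjV 𝕄_j (diagK (X2s_jᵀ − X2s_j)) + ½•(Δ_j + Δ_jᵀ)` the W-remainder of `SpineRecursiveWLawSym`)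
* `loc_WRem_sym`: `Rm_j` is localised (given `Loc (diagK X2s_j)`, `Loc Δ_j`; spread `𝕄_j` from (Dspr)).
* **`T2RecOf_bref_all_of_letters_sym`**: `∀ j α κ u κ′ u′`, (hT2-rem)(j) for `T2RecOf d Lc (Gsym Lc) Sp (M1Of H cΛ) …` with second symbols `h j α` and
  remainders `R2 j α`, BY INDUCTION ON `j` from: (h0) the level-`0` letter [(W-LET-S₂)₀: Wilson (2,2) reflection at level 0 (an3 `WilsonReflectionContact2`) +
  the border table's level-0 letter — an1 S2b]; (hM2) the mixed letter ∀ j with remainder `RM` [(W-LET-M₂), an1 S2b]; (hsplit)∕(hDg)∕(hX2L)∕(hΔL) the split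
  identities and localisations ∀ j [mechanical]; (hBfm∕hBmf∕hBmm)+(hRBff) THE BORDER LETTER at every level `j+1` [(W-0B), an1 S2b]; (hSp) the pure slot
  tables' (Sr-conj) law ∀ j [`ReflectionLocusSymPure.SpureSymOf_bref_all`]; (V-ff0), (H-r); the shift letters (Dspr)(Dnull)(Dff)(Dmm)(DG) [theorems at an1's
  `DshAn1.Dsh Lc`]; the locks `hlock`, `hlock2`; (hB0); and (hR2succ) THE REMAINDER RECURSION — `R2 (j+1)` IS the displayed remainder of the level step with
  `Rm := Rm_j`, INCLUDING the four inner sandwich-defect words (chart (II)).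
NOT HERE: the END (N7d: (Wr-conj-c) of `WsymOf` in g26's compensated shape from (hT2-rem) + (hM2) + (hsplit) — twin of `SpineRecursiveWEnd`), the
table-level shape ∕ parity of the defect words (an3's audit ∕ (N8)).  Provenance: β sub-cell, unit beta-an2 gen 31, 2026-08-21 (v1); no existing file touched.
-/

open Finset
open scoped BigOperators
open Literature.Probability.LatticeModels (Torus.proj)
open Literature.MathematicalPhysics.QuantumFieldTheory
open Literature.MathematicalPhysics.QuantumFieldTheory.Balaban1983to89
open Literature.MathematicalPhysics.QuantumFieldTheory.Balaban1983to89.Beta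
open ExpKernelCalculus (MKer Decays BiLoc comp VertexFamily)
open PolarizationSign (reflSign)
open KernelReflection (refK)
open ResolventReflection (bref Φ)
open OneStepResolventKernel (Fib LocStencil)
open OneStepKernelFamily (KInvStep colH)
open BalabanStepJetsSucc (mmRead wE wVH)
open BalabanStepW2 (M2Of wV4 wB2)
open BalabanCompositeJets (LocStencil₂)
open SecondOrderResponse (dM W2OfK LocStencilFM)
open Summit.QuantumFields.BalabanUV.Beta.TameKernelCalculus
open Summit.QuantumFields.BalabanUV.Beta.ChartConjugation (conjV conjW loc_conjV)
open Summit.QuantumFields.BalabanUV.Beta.BorderedHessian (bhK diagK diagK_apply stepScale)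
open Summit.QuantumFields.BalabanUV.Beta.SymSliceProjectorKernel (symEc)
open Summit.QuantumFields.BalabanUV.Beta.WardLocusCubic (mmSym)
open Summit.QuantumFields.BalabanUV.Beta.ChartConjugationDefectEnd (sandwichDefect)
open Summit.QuantumFields.BalabanUV.Beta.SymmetrisedStepJets (Gsym)
open Summit.QuantumFields.BalabanUV.Beta.SymShiftedSpread (bhKStepSh spr_bhKStepSh)
open Summit.QuantumFields.BalabanUV.Beta.E3ContactGenerator (ctGenM)
open Summit.QuantumFields.BalabanUV.Beta.SecondOrderSymContact (loc_rem)

noncomputable section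

namespace Summit.QuantumFields.BalabanUV.Beta.SpineRooted

section AllSym

variable {d Lc : ℕ} [NeZero Lc]

/-- [folklore] **THE W-REMAINDER AT THE SHIFTED SPREAD IS LOCALISED** (given `Loc (diagK X2s)`, `Loc Δ`, (Dspr)). -/
theorem loc_WRem_sym {Dsh : MKer (d + 1) (Fib d)} (hDs : Spr Dsh) {j : ℕ}
    {X2s : Fin (d + 1) → (Fin (d + 1) → ℤ) → Fin (d + 1) → (Fin (d + 1) → ℤ) → (Fin (d + 1) → ℤ) → Fib d → ℝ}
    {Δ : Fin (d + 1) → (Fin (d + 1) → ℤ) → Fin (d + 1) → (Fin (d + 1) → ℤ) → MKer (d + 1) (Fib d)}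
    (hX2L : ∀ μ y ν y', Loc (diagK (X2s μ y ν y'))) (hΔL : ∀ μ y ν y', Loc (Δ μ y ν y')) (μ : Fin (d + 1)) (y : Fin (d + 1) → ℤ) (ν : Fin (d + 1))
    (y' : Fin (d + 1) → ℤ) :
    Loc ((1 / 2 : ℝ) • conjV (bhKStepSh d Lc Dsh j) (diagK fun p a => X2s ν y' μ y p a - X2s μ y ν y' p a) +
      (1 / 2 : ℝ) • (Δ μ y ν y' + Δ ν y' μ y)) := by
  have e : (diagK fun p a => X2s ν y' μ y p a - X2s μ y ν y' p a) = diagK (X2s ν y' μ y) - diagK (X2s μ y ν y') := by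
    funext x z a b
    rw [Pi.sub_apply, Pi.sub_apply, Pi.sub_apply, Pi.sub_apply, diagK_apply, diagK_apply, diagK_apply]
    split_ifs <;> ring
  have hdiff : Loc (diagK fun p a => X2s ν y' μ y p a - X2s μ y ν y' p a) := by
    rw [e]; exact (hX2L ν y' μ y).sub (hX2L μ y ν y')
  exact loc_rem (loc_conjV (spr_bhKStepSh hDs j) hdiff) (hΔL μ y ν y') (hΔL ν y' μ y)

/-- [folklore] **(hT2-rem) AT EVERY LEVEL FOR THE SLOTTED TABLES AT THE SYMMETRISED RESOLVENTS, BY INDUCTION FROM THE LETTERS** (see the module docstring;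
every letter is a hypothesis; the remainder `R2` is DEFINED by the user through (hR2succ)). -/
theorem T2RecOf_bref_all_of_letters_sym (hLc : Odd Lc) {Dsh : MKer (d + 1) (Fib d)} (hDs : Spr Dsh)
    (hDnull : comp (comp (symEc Lc) Dsh) (symEc Lc) = 0)
    (hDff : ∀ (x z : Fin (d + 1) → ℤ) (β β' : Fin (d + 1)), Dsh x z (Sum.inl β) (Sum.inl β') = 0)
    (hDmm : ∀ (x y : Fin (d + 1) → ℤ) (κ l : Fin (d + 1)), Dsh x y (Sum.inr κ) (Sum.inr l) = 0)
    (hGD : ∀ (j : ℕ) (x z : Fin (d + 1) → ℤ) (m a : Fin (d + 1)), comp (Gsym (d := d) Lc j) Dsh x z (Sum.inr m) (Sum.inl a) = 0)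
    (hDG : ∀ (j : ℕ) (x z : Fin (d + 1) → ℤ) (a m : Fin (d + 1)), comp Dsh (Gsym (d := d) Lc j) x z (Sum.inl a) (Sum.inr m) = 0)
    {V H : Fin (d + 1) → (Fin (d + 1) → ℤ) → MKer (d + 1) (Fib d)}
    (hV : ∀ δ : ℝ, 0 ≤ δ → ∃ C : ℝ, LocStencil V C δ) (hH : ∀ δ : ℝ, 0 ≤ δ → ∃ C : ℝ, VertexFamily H Lc C δ)
    (hV0 : ∀ (κ : Fin (d + 1)) (w x z : Fin (d + 1) → ℤ) (β β' : Fin (d + 1)), V κ w x z (Sum.inl β) (Sum.inl β') = 0)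
    (hHr : ∀ (α μ : Fin (d + 1)) (y : Fin (d + 1) → ℤ), H μ (bref α μ y) = reflSign α μ • refK (Φ (d := d) Lc α) (H μ y))
    (cE cVH cΛ cE₂ cB : ℝ) (T : Fin 4 → Fin 4 → Fin 4 → Fin 4 → ℝ)
    {vh₂S : Fin (d + 1) → (Fin (d + 1) → ℤ) → Fin (d + 1) → (Fin (d + 1) → ℤ) → MKer (d + 1) (Fib d)} (hB2 : ∃ C δ : ℝ, 0 < δ ∧ LocStencil₂ vh₂S C δ)
    (hB0 : ∀ κ u κ' u' (x z : Fin (d + 1) → ℤ) (β β' : Fin (d + 1)), vh₂S κ u κ' u' x z (Sum.inl β) (Sum.inl β') = 0)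
    {mixFF : Fin (d + 1) → (Fin (d + 1) → ℤ) → Fin (d + 1) → (Fin (d + 1) → ℤ) → MKer (d + 1) (Fib d)} (hmix : ∃ C δ : ℝ, 0 < δ ∧ LocStencilFM Lc mixFF C δ)
    (γ : ℕ → ℝ)
    (hlock : ∀ j, cE * wE d Lc (j + 1) * (γ j / (stepScale d Lc j * (Lc : ℝ) ^ (d + 1))) / wVH d Lc (j + 1) = γ (j + 1))
    (hlock2 : ∀ j, cE₂ * wV4 d Lc (j + 1) * wVH d Lc (j + 1) = (cE * wE d Lc (j + 1)) ^ 2)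
    (hSp : ∀ (j : ℕ) (α κ : Fin (d + 1)) (u : Fin (d + 1) → ℤ), SpureRecOf d Lc V H (Gsym Lc) cE cVH cΛ j κ (bref α κ u) = reflSign α κ • refK (Φ Lc α)
      (SpureRecOf d Lc V H (Gsym Lc) cE cVH cΛ j κ u + conjV (bhKStepSh d Lc Dsh j) (diagK fun p c => γ j * ctGenM d (bhK Lc + Dsh) α Lc κ u p c)))
    (h : ℕ → Fin (d + 1) → Fin (d + 1) → (Fin (d + 1) → ℤ) → Fin (d + 1) → (Fin (d + 1) → ℤ) → (Fin (d + 1) → ℤ) → Fib d → ℝ)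
    (R2 : ℕ → Fin (d + 1) → Fin (d + 1) → (Fin (d + 1) → ℤ) → Fin (d + 1) → (Fin (d + 1) → ℤ) → MKer (d + 1) (Fib d))
    (RM : ℕ → Fin (d + 1) → Fin (d + 1) → (Fin (d + 1) → ℤ) → Fin (d + 1) → (Fin (d + 1) → ℤ) → MKer (d + 1) (Fib d))
    (h0 : ∀ (α κ : Fin (d + 1)) (u : Fin (d + 1) → ℤ) (κ' : Fin (d + 1)) (u' : Fin (d + 1) → ℤ),
      T2RecOf d Lc (Gsym Lc) (SpureRecOf d Lc V H (Gsym Lc) cE cVH cΛ) (M1Of d Lc H cΛ) cE₂ cB T vh₂S mixFF 0 κ (bref α κ u) κ' (bref α κ' u') =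
        (reflSign α κ * reflSign α κ') • refK (Φ Lc α)
          (T2RecOf d Lc (Gsym Lc) (SpureRecOf d Lc V H (Gsym Lc) cE cVH cΛ) (M1Of d Lc H cΛ) cE₂ cB T vh₂S mixFF 0 κ u κ' u' +
            conjW (bhKStepSh d Lc Dsh 0) (SpureRecOf d Lc V H (Gsym Lc) cE cVH cΛ 0 κ u) (SpureRecOf d Lc V H (Gsym Lc) cE cVH cΛ 0 κ' u')
              (diagK fun p c => γ 0 * ctGenM d (bhK Lc + Dsh) α Lc κ u p c) (diagK fun p c => γ 0 * ctGenM d (bhK Lc + Dsh) α Lc κ' u' p c) (diagK (h 0 α κ u κ' u')) +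
            R2 0 α κ u κ' u'))
    (hM2 : ∀ (j : ℕ) (α κ : Fin (d + 1)) (u : Fin (d + 1) → ℤ) (ρ : Fin (d + 1)) (w : Fin (d + 1) → ℤ),
      M2Of d Lc mixFF j κ (bref α κ u) ρ (bref α ρ w) =
        (reflSign α κ * reflSign α ρ) • refK (Φ Lc α)
          (M2Of d Lc mixFF j κ u ρ w + conjV (M1Of d Lc H cΛ j ρ w) (diagK fun p c => γ j * ctGenM d (bhK Lc + Dsh) α Lc κ u p c) + RM j α κ u ρ w))
    (X2s : ℕ → Fin (d + 1) → Fin (d + 1) → (Fin (d + 1) → ℤ) → Fin (d + 1) → (Fin (d + 1) → ℤ) → (Fin (d + 1) → ℤ) → Fib d → ℝ)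
    (Δ : ℕ → Fin (d + 1) → Fin (d + 1) → (Fin (d + 1) → ℤ) → Fin (d + 1) → (Fin (d + 1) → ℤ) → MKer (d + 1) (Fib d))
    (hsplit : ∀ (j : ℕ) (α μ : Fin (d + 1)) (y : Fin (d + 1) → ℤ) (ν : Fin (d + 1)) (y' : Fin (d + 1) → ℤ),
      W2OfK (Gsym (d := d) Lc j) Lc
          (fun κ u => SpureRecOf d Lc V H (Gsym Lc) cE cVH cΛ j κ u + conjV (bhKStepSh d Lc Dsh j) (diagK fun p c => γ j * ctGenM d (bhK Lc + Dsh) α Lc κ u p c))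
          (M1Of d Lc H cΛ j)
          (fun κ u κ' u' => T2RecOf d Lc (Gsym Lc) (SpureRecOf d Lc V H (Gsym Lc) cE cVH cΛ) (M1Of d Lc H cΛ) cE₂ cB T vh₂S mixFF j κ u κ' u' +
            conjW (bhKStepSh d Lc Dsh j) (SpureRecOf d Lc V H (Gsym Lc) cE cVH cΛ j κ u) (SpureRecOf d Lc V H (Gsym Lc) cE cVH cΛ j κ' u')
              (diagK fun p c => γ j * ctGenM d (bhK Lc + Dsh) α Lc κ u p c) (diagK fun p c => γ j * ctGenM d (bhK Lc + Dsh) α Lc κ' u' p c) (diagK (h j α κ u κ' u')) +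
            R2 j α κ u κ' u')
          (fun κ u ρ w => M2Of d Lc mixFF j κ u ρ w + conjV (M1Of d Lc H cΛ j ρ w) (diagK fun p c => γ j * ctGenM d (bhK Lc + Dsh) α Lc κ u p c) + RM j α κ u ρ w)
          μ y ν y' =
        W2OfK (Gsym (d := d) Lc j) Lc (SpureRecOf d Lc V H (Gsym Lc) cE cVH cΛ j) (M1Of d Lc H cΛ j) (T2RecOf d Lc (Gsym Lc) (SpureRecOf d Lc V H (Gsym Lc) cE cVH cΛ) (M1Of d Lc H cΛ) cE₂ cB T vh₂S mixFF j) (M2Of d Lc mixFF j) μ y ν y' +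
          conjW (bhKStepSh d Lc Dsh j)
            (dM (Gsym Lc j) Lc (SpureRecOf d Lc V H (Gsym Lc) cE cVH cΛ j) (M1Of d Lc H cΛ j) μ y) (dM (Gsym Lc j) Lc (SpureRecOf d Lc V H (Gsym Lc) cE cVH cΛ j) (M1Of d Lc H cΛ j) ν y')
            (diagK fun p c => ∑ κ, ∑' u, colH (Gsym Lc j) Lc μ y κ u * (γ j * ctGenM d (bhK Lc + Dsh) α Lc κ u p c)) (diagK fun p c => ∑ κ, ∑' u, colH (Gsym Lc j) Lc ν y' κ u * (γ j * ctGenM d (bhK Lc + Dsh) α Lc κ u p c))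
            (diagK (X2s j α μ y ν y')) +
          Δ j α μ y ν y')
    (hDg : ∀ (j : ℕ) (α ν : Fin (d + 1)) (y' : Fin (d + 1) → ℤ),
      Loc (dM (Gsym (d := d) Lc j) Lc (fun κ u => SpureRecOf d Lc V H (Gsym Lc) cE cVH cΛ j κ u + conjV (bhKStepSh d Lc Dsh j) (diagK fun p c => γ j * ctGenM d (bhK Lc + Dsh) α Lc κ u p c)) (M1Of d Lc H cΛ j) ν y'))
    (hX2L : ∀ j α μ y ν y', Loc (diagK (X2s j α μ y ν y'))) (hΔL : ∀ j α μ y ν y', Loc (Δ j α μ y ν y'))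
    (RB : ℕ → Fin (d + 1) → Fin (d + 1) → (Fin (d + 1) → ℤ) → Fin (d + 1) → (Fin (d + 1) → ℤ) → MKer (d + 1) (Fib d))
    (hRBff : ∀ j α κ u κ' u' (x z : Fin (d + 1) → ℤ) (β β' : Fin (d + 1)), RB j α κ u κ' u' x z (Sum.inl β) (Sum.inl β') = 0)
    (hBfm : ∀ (j : ℕ) (α : Fin (d + 1)) κ u κ' u' (x z : Fin (d + 1) → ℤ) (β m : Fin (d + 1)),
      ((cB * wB2 d Lc (j + 1)) • vh₂S κ (bref α κ u) κ' (bref α κ' u')) x z (Sum.inl β) (Sum.inr m) =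
        ((reflSign α κ * reflSign α κ') • refK (Φ Lc α) ((cB * wB2 d Lc (j + 1)) • vh₂S κ u κ' u' +
          conjW (bhKStepSh d Lc Dsh (j + 1)) (SpureRecOf d Lc V H (Gsym Lc) cE cVH cΛ (j + 1) κ u) (SpureRecOf d Lc V H (Gsym Lc) cE cVH cΛ (j + 1) κ' u')
            (diagK fun p c => γ (j + 1) * ctGenM d (bhK Lc + Dsh) α Lc κ u p c) (diagK fun p c => γ (j + 1) * ctGenM d (bhK Lc + Dsh) α Lc κ' u' p c)
            (diagK (h (j + 1) α κ u κ' u')) + RB (j + 1) α κ u κ' u')) x z (Sum.inl β) (Sum.inr m))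
    (hBmf : ∀ (j : ℕ) (α : Fin (d + 1)) κ u κ' u' (x z : Fin (d + 1) → ℤ) (m β : Fin (d + 1)),
      ((cB * wB2 d Lc (j + 1)) • vh₂S κ (bref α κ u) κ' (bref α κ' u')) x z (Sum.inr m) (Sum.inl β) =
        ((reflSign α κ * reflSign α κ') • refK (Φ Lc α) ((cB * wB2 d Lc (j + 1)) • vh₂S κ u κ' u' +
          conjW (bhKStepSh d Lc Dsh (j + 1)) (SpureRecOf d Lc V H (Gsym Lc) cE cVH cΛ (j + 1) κ u) (SpureRecOf d Lc V H (Gsym Lc) cE cVH cΛ (j + 1) κ' u')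
            (diagK fun p c => γ (j + 1) * ctGenM d (bhK Lc + Dsh) α Lc κ u p c) (diagK fun p c => γ (j + 1) * ctGenM d (bhK Lc + Dsh) α Lc κ' u' p c)
            (diagK (h (j + 1) α κ u κ' u')) + RB (j + 1) α κ u κ' u')) x z (Sum.inr m) (Sum.inl β))
    (hBmm : ∀ (j : ℕ) (α : Fin (d + 1)) κ u κ' u' (x z : Fin (d + 1) → ℤ) (m m' : Fin (d + 1)),
      ((cB * wB2 d Lc (j + 1)) • vh₂S κ (bref α κ u) κ' (bref α κ' u')) x z (Sum.inr m) (Sum.inr m') =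
        ((reflSign α κ * reflSign α κ') • refK (Φ Lc α) ((cB * wB2 d Lc (j + 1)) • vh₂S κ u κ' u' +
          conjW (bhKStepSh d Lc Dsh (j + 1)) (SpureRecOf d Lc V H (Gsym Lc) cE cVH cΛ (j + 1) κ u) (SpureRecOf d Lc V H (Gsym Lc) cE cVH cΛ (j + 1) κ' u')
            (diagK fun p c => γ (j + 1) * ctGenM d (bhK Lc + Dsh) α Lc κ u p c) (diagK fun p c => γ (j + 1) * ctGenM d (bhK Lc + Dsh) α Lc κ' u' p c)
            (diagK (h (j + 1) α κ u κ' u')) + RB (j + 1) α κ u κ' u')) x z (Sum.inr m) (Sum.inr m'))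
    (hR2succ : ∀ (j : ℕ) (α κ : Fin (d + 1)) (u : Fin (d + 1) → ℤ) (κ' : Fin (d + 1)) (u' : Fin (d + 1) → ℤ),
      R2 (j + 1) α κ u κ' u' =
          (-((cE₂ * wV4 d Lc (j + 1)) • mmRead Lc
              (comp (comp (Gsym Lc j) (((1 / 2 : ℝ) • conjV (bhKStepSh d Lc Dsh j) (diagK fun p a => X2s j α κ' u' κ u p a - X2s j α κ u κ' u' p a) +
                (1 / 2 : ℝ) • (Δ j α κ u κ' u' + Δ j α κ' u' κ u)))) (Gsym Lc j) -
                (comp (sandwichDefect (Gsym Lc j) (bhKStepSh d Lc Dsh j)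
                      (diagK fun p c => ∑ ι, ∑' v, colH (Gsym Lc j) Lc κ u ι v * (γ j * ctGenM d (bhK Lc + Dsh) α Lc ι v p c)))
                    (comp (dM (Gsym Lc j) Lc (SpureRecOf d Lc V H (Gsym Lc) cE cVH cΛ j) (M1Of d Lc H cΛ j) κ' u') (Gsym Lc j) -
                      diagK fun p c => ∑ ι, ∑' v, colH (Gsym Lc j) Lc κ' u' ι v * (γ j * ctGenM d (bhK Lc + Dsh) α Lc ι v p c))
                  + comp (comp (Gsym Lc j) (dM (Gsym Lc j) Lc (SpureRecOf d Lc V H (Gsym Lc) cE cVH cΛ j) (M1Of d Lc H cΛ j) κ u +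
                      conjV (bhKStepSh d Lc Dsh j) (diagK fun p c => ∑ ι, ∑' v, colH (Gsym Lc j) Lc κ u ι v * (γ j * ctGenM d (bhK Lc + Dsh) α Lc ι v p c))))
                    (sandwichDefect (Gsym Lc j) (bhKStepSh d Lc Dsh j)
                      (diagK fun p c => ∑ ι, ∑' v, colH (Gsym Lc j) Lc κ' u' ι v * (γ j * ctGenM d (bhK Lc + Dsh) α Lc ι v p c)))
                  + comp (sandwichDefect (Gsym Lc j) (bhKStepSh d Lc Dsh j)
                      (diagK fun p c => ∑ ι, ∑' v, colH (Gsym Lc j) Lc κ' u' ι v * (γ j * ctGenM d (bhK Lc + Dsh) α Lc ι v p c)))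
                    (comp (dM (Gsym Lc j) Lc (SpureRecOf d Lc V H (Gsym Lc) cE cVH cΛ j) (M1Of d Lc H cΛ j) κ u) (Gsym Lc j) -
                      diagK fun p c => ∑ ι, ∑' v, colH (Gsym Lc j) Lc κ u ι v * (γ j * ctGenM d (bhK Lc + Dsh) α Lc ι v p c))
                  + comp (comp (Gsym Lc j) (dM (Gsym Lc j) Lc (SpureRecOf d Lc V H (Gsym Lc) cE cVH cΛ j) (M1Of d Lc H cΛ j) κ' u' +
                      conjV (bhKStepSh d Lc Dsh j) (diagK fun p c => ∑ ι, ∑' v, colH (Gsym Lc j) Lc κ' u' ι v * (γ j * ctGenM d (bhK Lc + Dsh) α Lc ι v p c))))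
                    (sandwichDefect (Gsym Lc j) (bhKStepSh d Lc Dsh j)
                      (diagK fun p c => ∑ ι, ∑' v, colH (Gsym Lc j) Lc κ u ι v * (γ j * ctGenM d (bhK Lc + Dsh) α Lc ι v p c)))))) +
            RB (j + 1) α κ u κ' u' +
            conjV (mmRead Lc (Gsym (d := d) Lc j))
              (diagK fun p c => cE₂ * wV4 d Lc (j + 1) * mmSym Lc (X2s j α κ u κ' u') p c - wVH d Lc (j + 1) * h (j + 1) α κ u κ' u' p c))) :
    ∀ (j : ℕ) (α κ : Fin (d + 1)) (u : Fin (d + 1) → ℤ) (κ' : Fin (d + 1)) (u' : Fin (d + 1) → ℤ),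
      T2RecOf d Lc (Gsym Lc) (SpureRecOf d Lc V H (Gsym Lc) cE cVH cΛ) (M1Of d Lc H cΛ) cE₂ cB T vh₂S mixFF j κ (bref α κ u) κ' (bref α κ' u') =
        (reflSign α κ * reflSign α κ') • refK (Φ Lc α)
          (T2RecOf d Lc (Gsym Lc) (SpureRecOf d Lc V H (Gsym Lc) cE cVH cΛ) (M1Of d Lc H cΛ) cE₂ cB T vh₂S mixFF j κ u κ' u' +
            conjW (bhKStepSh d Lc Dsh j) (SpureRecOf d Lc V H (Gsym Lc) cE cVH cΛ j κ u) (SpureRecOf d Lc V H (Gsym Lc) cE cVH cΛ j κ' u')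
              (diagK fun p c => γ j * ctGenM d (bhK Lc + Dsh) α Lc κ u p c) (diagK fun p c => γ j * ctGenM d (bhK Lc + Dsh) α Lc κ' u' p c) (diagK (h j α κ u κ' u')) +
            R2 j α κ u κ' u') := by
  intro j
  induction j with
  | zero => exact h0
  | succ j ih =>
    intro α κ u κ' u'
    have hW := WrecOf_bref_of_T2RM_sym hLc hHr cE cVH cΛ cE₂ cB T vh₂S mixFF γ j α (hSp j α) (h j α) (R2 j α) (RM j α) (ih α) (hM2 j α) (X2s j α)
      (Δ j α) (hsplit j α) (hDg j α)
    rw [hR2succ j α κ u κ' u']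
    exact T2RecOf_succ_bref_of_laws_sym hLc hDs hDnull hDff hDmm hGD hDG hV hH hV0 hHr cE cVH cΛ cE₂ cB T hB2 hB0 hmix γ hlock hlock2 j α (hSp j α)
      (X2s j α) _ (hX2L j α) (loc_WRem_sym hDs (hX2L j α) (hΔL j α)) hW (h (j + 1) α) (RB (j + 1) α) (hRBff (j + 1) α) (hBfm j α) (hBmf j α)
      (hBmm j α) κ u κ' u'

end AllSym

end Summit.QuantumFields.BalabanUV.Beta.SpineRooted

end
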